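import Literature.MathematicalPhysics.QuantumLattice.LindhardSRepresentation
import Summits.HubbardSuperconductivity.HubbardSuperconductivity.Theses.WeakCouplingBCS
import HarnessLib

/-!
# Route `WeakCouplingBCS` — support item `LindhardPointwiseIdentification` (stmt-HubbardSuperconductivity-19294): closer

The pointwise s-representation of the square-lattice Lindhard function is proved Literature-side in
`Literature/MathematicalPhysics/QuantumLattice/LindhardSRepresentation.lean`
(`lindhardFunction_squareDispersion_eq_sRepresentation`, cell `gate-hubbard-kl`, seat t2 g3); this
file closes the Theses item BY NAME.
-/

-- the tree's namespace `Summit.<Summit>.<Problem>.Theorems` repeats the summit name by design (D-0017)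
set_option linter.dupNamespace false

namespace Summit.HubbardSuperconductivity.HubbardSuperconductivity.Theorems

/-- stmt-HubbardSuperconductivity-19294 `LindhardPointwiseIdentification` holds (REF-CHECK §8.7 (β)
for the Kohn–Luttinger certificates stmt-0158 / stmt-1741): for `-4 < μ < 0` and `q ∉ 2πℤ²`,
`lindhardFunction ε₀ μ q = (∫₀¹ (fermiCurveMeasure ε_s μ univ).toReal ds)/(2π)²` — by
`Literature.MathematicalPhysics.QuantumLattice.lindhardFunction_squareDispersion_eq_sRepresentation`. -/
theorem lindhardPointwiseIdentification_proof :
    Summit.HubbardSuperconductivity.HubbardSuperconductivity.Theses.WeakCouplingBCS.LindhardPointwiseIdentification :=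
  fun μ hμ q hq =>
    Literature.MathematicalPhysics.QuantumLattice.lindhardFunction_squareDispersion_eq_sRepresentation μ hμ q hq

end Summit.HubbardSuperconductivity.HubbardSuperconductivity.Theorems
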